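import Summits.Ventures.PercRepro.Night2LocalRuleLossFair

/-!
# PercRepro — the HYBRID rule: definitions, nonnegativity, support (night-2, gen 24)

Rule L2F (`Night2LocalRuleLossFair`) routes EVERY loss fair-share over all far supersets.  On the nested-line
geometries of the `(7, 5)` cells `(2, 0)`, `(2, 1)`, `(3, 2)` that rule fails (proofs/NIGHT-2-g24.md §8: the top
targets receive the shares of `2^{|L|}` saturated covering sets, min per-loss ratio `0.775` at `L = 11`, `0.520` at
`L = 12`), while a rule that routes the losses of the BIG members (a predicate `P` on the members) by a separate
share function `dsh` — at distance one, to the spanning supersets outside the common closure of the requesting faces —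
and the other losses fair-share with the capacity left passes with constant load.  This module types that certificate
with `P` and `dsh` ABSTRACT:

* `dload S = Σ_{thin B with P B} Σ_{z ∈ G ∖ cl B} dsh B z S` — the distance-one load of a target;
* `cap3 S = cap2 S − dload S` — the capacity left for the fair-share layer;
* `pi2MassH` / `lossIncomeH` / `shareH` / `w2H` — the fair-share layer of `Night2LocalRuleLossFair` restricted to the
  members without `P`, with `cap3` in place of `cap2`;
* `w2D` — the distance-one layer (the shares `dsh` of the members with `P`);
The rows, columns and the certificate **`localShadowHall_of_hybrid`** are in `Night2LocalRuleHybrid`.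
-/

namespace PercRepro.Shadow

open Finset PerFlat ThmH

variable {α : Type*} [DecidableEq α] {M : Matroid α} [M.Finite]

section Hybrid

variable (M) (q : ℕ) (G : Finset α) (P : Finset α → Prop) [DecidablePred P] (dsh : Finset α → α → Finset α → ℚ)

open scoped Classical in
/-- The distance-one load of a target: the shares `dsh` of the losses of the `P`-members. -/
noncomputable def dload (S : Finset α) : ℚ :=
  ∑ B ∈ (thinMembers M q G).filter P, ∑ z ∈ G \ clF M B, dsh B z S

/-- The capacity left for the fair-share layer after the distance-one loads. -/
noncomputable def cap3 (S : Finset α) : ℚ := cap2 M q G S - dload M q G P dsh S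

open scoped Classical in
/-- The loss mass of the non-`P` pairs targeting `S`. -/
noncomputable def pi2MassH (S : Finset α) : ℚ :=
  ∑ B ∈ (thinMembers M q G).filter (fun B => ¬ P B), ∑ z ∈ G \ clF M B,
    if S ∈ tgtSets M q G B z then rhoL M q G B z else 0

/-- The fair-share income of a non-`P` loss with the capacities `cap3`. -/
noncomputable def lossIncomeH (B : Finset α) (z : α) : ℚ :=
  ∑ S ∈ tgtSets M q G B z, cap3 M q G P dsh S / pi2MassH M q G P S

/-- The share of a non-`P` loss received by `S`. -/
noncomputable def shareH (B : Finset α) (z : α) (S : Finset α) : ℚ :=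
  if loss M q G B z = 0 then 0
  else loss M q G B z * (cap3 M q G P dsh S / pi2MassH M q G P S) / lossIncomeH M q G P dsh B z

open scoped Classical in
/-- The fair-share layer of the non-`P` members. -/
noncomputable def w2H (B S : Finset α) : ℚ :=
  if B ∈ thinMembers M q G ∧ ¬ P B then
    ∑ z ∈ G \ clF M B, if S ∈ tgtSets M q G B z then shareH M q G P dsh B z S else 0
  else 0

open scoped Classical in
/-- The distance-one layer of the `P`-members. -/
noncomputable def w2D (B S : Finset α) : ℚ :=
  if B ∈ thinMembers M q G ∧ P B then ∑ z ∈ G \ clF M B, dsh B z S else 0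

/-- The hybrid rule: layers 0, 1, the distance-one layer and the fair-share layer. -/
noncomputable def wHybrid (B S : Finset α) : ℚ :=
  w0 M q G B S + w1 M q G B S + w2D M q G P dsh B S + w2H M q G P dsh B S

end Hybrid

section HybridLemmas

variable {q : ℕ} {G : Finset α} {P : Finset α → Prop} [DecidablePred P] {dsh : Finset α → α → Finset α → ℚ}

/-! ## Nonnegativity -/

open scoped Classical in
/-- The distance-one loads are nonnegative. -/
theorem dload_nonneg (hds : ∀ B z S, 0 ≤ dsh B z S) (S : Finset α) : 0 ≤ dload M q G P dsh S := by
  unfold dload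
  exact Finset.sum_nonneg (fun B _ => Finset.sum_nonneg (fun z _ => hds B z S))

/-- `cap3 S ≥ 0` when the distance-one load stays within `cap2 S`. -/
theorem cap3_nonneg {S : Finset α} (hdl : dload M q G P dsh S ≤ cap2 M q G S) : 0 ≤ cap3 M q G P dsh S := by
  unfold cap3; linarith

open scoped Classical in
/-- The loss mass of the non-`P` pairs is nonnegative. -/
theorem pi2MassH_nonneg (hG : G ∈ flatsQ M (q + 1)) (hd : (gr M \ G).card ≤ q) (S : Finset α) :
    0 ≤ pi2MassH M q G P S := by
  unfold pi2MassH
  apply Finset.sum_nonneg; intro B _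
  apply Finset.sum_nonneg; intro z _
  split_ifs
  · exact rhoL_nonneg hG hd B z
  · exact le_refl _

/-- The fair-share incomes are nonnegative (loads within `cap2`). -/
theorem lossIncomeH_nonneg (hG : G ∈ flatsQ M (q + 1)) (hd : (gr M \ G).card ≤ q)
    (hdl : ∀ S ∈ shadowAt M (q + 2) q (Uq M (q + 2) q) G, dload M q G P dsh S ≤ cap2 M q G S)
    (B : Finset α) (z : α) : 0 ≤ lossIncomeH M q G P dsh B z := by
  unfold lossIncomeH
  apply Finset.sum_nonneg
  intro S hS
  exact div_nonneg (cap3_nonneg (hdl S (mem_tgtSets.1 hS).1)) (pi2MassH_nonneg hG hd S)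

/-- Under the per-loss condition a positive loss has positive weight and positive income. -/
theorem lossIncomeH_pos (hG : G ∈ flatsQ M (q + 1)) (hd : (gr M \ G).card ≤ q)
    (hdl : ∀ S ∈ shadowAt M (q + 2) q (Uq M (q + 2) q) G, dload M q G P dsh S ≤ cap2 M q G S)
    {B : Finset α} {z : α} (hl : loss M q G B z ≠ 0)
    (hcond : loss M q G B z ≤ rhoL M q G B z * lossIncomeH M q G P dsh B z) :
    0 < rhoL M q G B z ∧ 0 < lossIncomeH M q G P dsh B z := by
  have hl' : 0 < loss M q G B z := lt_of_le_of_ne (loss_nonneg' hG hd B z) (Ne.symm hl)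
  have h1 := rhoL_nonneg hG hd B z
  have h2 := lossIncomeH_nonneg hG hd hdl B z
  refine ⟨?_, ?_⟩
  · rcases h1.lt_or_eq with h | h
    · exact h
    · rw [← h, zero_mul] at hcond; exact absurd hcond (not_le.2 hl')
  · rcases h2.lt_or_eq with h | h
    · exact h
    · rw [← h, mul_zero] at hcond; exact absurd hcond (not_le.2 hl')

/-- Shares are nonnegative. -/
theorem shareH_nonneg (hG : G ∈ flatsQ M (q + 1)) (hd : (gr M \ G).card ≤ q)
    (hdl : ∀ S ∈ shadowAt M (q + 2) q (Uq M (q + 2) q) G, dload M q G P dsh S ≤ cap2 M q G S)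
    (B : Finset α) (z : α) {S : Finset α} (hS : S ∈ shadowAt M (q + 2) q (Uq M (q + 2) q) G) :
    0 ≤ shareH M q G P dsh B z S := by
  unfold shareH
  split_ifs
  · exact le_refl _
  · exact div_nonneg (mul_nonneg (loss_nonneg' hG hd B z)
      (div_nonneg (cap3_nonneg (hdl S hS)) (pi2MassH_nonneg hG hd S))) (lossIncomeH_nonneg hG hd hdl B z)

open scoped Classical in
/-- The fair-share layer is nonnegative. -/
theorem w2H_nonneg (hG : G ∈ flatsQ M (q + 1)) (hd : (gr M \ G).card ≤ q)
    (hdl : ∀ S ∈ shadowAt M (q + 2) q (Uq M (q + 2) q) G, dload M q G P dsh S ≤ cap2 M q G S)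
    (B S : Finset α) : 0 ≤ w2H M q G P dsh B S := by
  unfold w2H
  split_ifs
  · apply Finset.sum_nonneg; intro z _
    split_ifs with hS
    · exact shareH_nonneg hG hd hdl B z (mem_tgtSets.1 hS).1
    · exact le_refl _
  · exact le_refl _

open scoped Classical in
/-- The distance-one layer is nonnegative. -/
theorem w2D_nonneg (hds : ∀ B z S, 0 ≤ dsh B z S) (B S : Finset α) : 0 ≤ w2D M q G P dsh B S := by
  unfold w2D
  split_ifs
  · exact Finset.sum_nonneg (fun z _ => hds B z S)
  · exact le_refl _

/-! ## Support -/

open scoped Classical in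
/-- The fair-share layer is supported on containment. -/
theorem subset_of_w2H_ne {B S : Finset α} (h : w2H M q G P dsh B S ≠ 0) : B ⊆ S := by
  unfold w2H at h
  split_ifs at h with hB
  · obtain ⟨z, -, hz⟩ := Finset.exists_ne_zero_of_sum_ne_zero h
    split_ifs at hz with hS
    · exact (Finset.subset_insert z B).trans (mem_tgtSets.1 hS).2.1
    · exact absurd rfl hz
  · exact absurd rfl h

open scoped Classical in
/-- The distance-one layer is supported on containment. -/
theorem subset_of_w2D_ne (hsupp : ∀ B z S, dsh B z S ≠ 0 → insert z B ⊆ S) {B S : Finset α}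
    (h : w2D M q G P dsh B S ≠ 0) : B ⊆ S := by
  unfold w2D at h
  split_ifs at h with hB
  · obtain ⟨z, -, hz⟩ := Finset.exists_ne_zero_of_sum_ne_zero h
    exact (Finset.subset_insert z B).trans (hsupp B z S hz)
  · exact absurd rfl h

open scoped Classical in
/-- The hybrid rule is supported on containment. -/
theorem subset_of_wHybrid_ne (hsupp : ∀ B z S, dsh B z S ≠ 0 → insert z B ⊆ S) {B S : Finset α}
    (h : wHybrid M q G P dsh B S ≠ 0) : B ⊆ S := by
  unfold wHybrid at h
  by_cases h0 : w0 M q G B S = 0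
  · by_cases h1 : w1 M q G B S = 0
    · by_cases h2 : w2D M q G P dsh B S = 0
      · rw [h0, h1, h2, zero_add, zero_add, zero_add] at h
        exact subset_of_w2H_ne h
      · exact subset_of_w2D_ne hsupp h2
    · exact subset_of_w1_ne h1
  · exact subset_of_w0_ne h0

end HybridLemmas

end PercRepro.Shadow
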